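import Mathlib
import HarnessLib
import HarnessLib.Audit
import Summits.Langlands.Statement
import Summits.Langlands.Langlands.Theses.PrimeSwitchSplit
import Summits.Langlands.Langlands.Theses.MotivicDictionarySplit
import Summits.Langlands.Langlands.Theorems.HigherMotivicReciprocityAbelianTypeSplit
import Literature.AlgebraicGeometry.Motives.Varieties
import Literature.AlgebraicGeometry.Motives.GaloisRealization
import Literature.AlgebraicGeometry.Motives.EllAdicEtaleRational
import Literature.AlgebraicGeometry.Motives.AbelianVariety
import Literature.NumberTheory.Automorphic.GLnAdelicStructureProofs

set_option linter.dupNamespace false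
set_option linter.unusedVariables false

/-!
# AbelianTypeDissolution — lens-2 g33 node (structural dichotomy, special side): the abelian-type cell = GENERATORS + CLOSURE

seat `decomp-langlands-lens-2-g33` · 2026-08-31 · kit `run/shared/lean/pub/decomp-langlands/decomp-langlands-lens-2/g33/` (texts33.py renders every
statement below from the tree text of `Theses/MotivicDictionarySplit.lean`; the landed g32 cells are asserted byte-equal to texts32) · memo `AbelianTypeDissolution.md`.
LANGLANDS ROUTE FREEZE honoured: this file is TYPED-NOT-FILED by the seat (0 ledger writes); landing twin target
`Theorems/HigherMotivicReciprocityAbelianTypeDissolution.lean --supports stmt-Langlands-27426 --as helper` (census), hygiene: no decl named `closes`,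
no decl named like a route item, no cite-tags in the docstrings of section-variable defs (refs in prose).

## Target (tree decls BY NAME)
* ATR = `Summit.Langlands.Langlands.Theorems.AbelianTypeSplit.AbelianTypeReciprocity` — g32's SPECIAL cell of HMR (landed p828926, critic-CLEARED row 446
  with advisory «ATR dark: plan-only stubs, no seam; dial not Lean-instrumentable»);
* through g32's landed `AbelianTypeSplit.closes_target`: HMR = `Summit.Langlands.Langlands.Theses.MotivicDictionarySplit.HigherMotivicReciprocity`
  (stmt-Langlands-27426, crux r3, IDEA-NEEDED, route OPEN) → `MotivicDictionarySplit.closes` → B_w = `PrimeSwitchSplit.WeakGeometricAutomorphy` (17414)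
  → `PrimeSwitchSplit.closes` → `Langlands`.

## The move
g32 read the dial on the MOTIVE («∃ abelian variety A/K, ρ ⊂ Hⁱ(A)(j)»).  Read it on the GALOIS REPRESENTATION instead: **TT(ρ)** «ρ is an ε^j-twisted
Jordan–Hölder constituent of a tensor product ρs 0 ⊗ ⋯ ⊗ ρs (k-1) of WEIGHT-ONE FACTORS» (weight-one factor = irreducible, pinned-geometric, realisable in
some H¹(X) — VERBATIM the population of the parent's cell AVR = `MotivicDictionarySplit.AbelianMotivicReciprocity`, stmt-Langlands-27425; constituent =
the charpoly identity `charpoly ρ(g) · charpoly ρ'(g) = charpoly(ε(g)^j • ⨂ᵢ ρs i (g))` with a framed complement ρ' — Brauer–Nesbitt form, k-ary Kronecker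
product `kroneckerPi`).  Then reciprocity on the weight-one hull is LITERALLY

    GENERATORS (AVR, an existing item)  +  CLOSURE (TW1 := weak automorphy is closed under twisted tensor constituents of weakly automorphic weight-one irreducibles)

and the kernel proves `TTR ⟸ AVR ∧ TW1` (seam 1) by logic + the tree theorem `isCompact_glFiniteIntegralLevel_holds`.  The motivic dictionary
«abelian type ⟹ weight-one tensor type» (Hⁱ(A) = ⋀ⁱH¹ ⊂ ⊗ⁱH¹ by cup product — Milne AV Thm 15.1(b); Faltings semisimplicity; C_dR) is ONE print door
ATT, under which the special cell DISSOLVES: `ATR ⟸ AVR ∧ TW1 ∧ ATT` (seam 2), and with the converse door TTA (node-only) `ATR ⟺ TTR`.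

| piece | decl | kind / rank (in the would-be child route V-R′) | tag |
|---|---|---|---|
| TW1 | `WeightOneTensorTransport` | crux 2 — NEW lever (tensor-product functoriality on the Galois-attached spectrum) | WEAKER · S-implied (B_w ⟹ TCT ⟹ TW1) · ATTACKABLE-mod-print at shapes (2,2) Ramakrishnan 2000 / (2,3) Kim–Shahidi 2002, every K, irregular weight · IDEA-NEEDED beyond GL₂ × GL₃ |
| XRR | `AbelianTypeSplit.ExoticRegularReciprocity` | crux 3 — g32's landed cell, verbatim | WEAKER · S-implied · potential-automorphy land |
| AVR | `MotivicDictionarySplit.AbelianMotivicReciprocity` | crux 4 — SHARED item 27425 (the generators) | WEAKER · S-implied · shared |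
| XIR | `AbelianTypeSplit.ExoticIrregularReciprocity` | residual 5 — g32's landed cell, verbatim | BARRIER (NonRegularWeight ∧ ShimuraVarietyRealization) |
| ATT | `AbelianTypeIsTensorGenerated` | support — dictionary door, load-bearing | PRINT (Milne 15.1(b), Faltings 1983, C_dR) · NOT S-implied · ATTACKABLE as typing |
| Assembly | AVR → TW1 → ATT → XRR → XIR → HMR | assembly 1 | proved: `closes_hmr` (0 sorry) |

## Kernel (this file: rc 0 · 0 sorry · axioms [propext, Classical.choice, Quot.sound])
`tensorTypeReciprocity_of_pieces : AVR → TW1 → TTR` · `abelianTypeReciprocity_of_pieces : AVR → TW1 → ATT → ATR` (TARGET BY NAME) · `closes_hmr : AVR → TW1 → ATT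
→ XRR → XIR → HMR` (via g32's `closes_target`) · `closes_parent` (+NMR ⟹ B_w) · `closes_root` (+N0's five ⟹ `Langlands`) · certs `B_w ⟹ TCT ⟹ TW1`, `B_w ⟹ AVR/HMR/NMR`,
`HMR ⟹ TTR` · exactness `abelianTypeReciprocity_iff_tensorTypeReciprocity : ATT → TTA → (ATR ↔ TTR)` and
`weakGeometricAutomorphy_iff_pieces : ATT → (B_w ↔ AVR ∧ TW1 ∧ XRR ∧ XIR ∧ NMR)`.
bc7 (HarnessLib crux probe, batteries P1–P5, 90 s budget): TW1 CLEAN vs `Langlands` and vs HMR; ATT CLEAN vs `Langlands`, vs HMR and vs ATR; XRR/XIR CLEAN of record (g32).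
Vehicles (pen-holders', see RUNME.md): LINE `abelian-type-dissolved` on 27426 (5 stubs, = registered line `abelian_type` with its dark first stub split
into AVR ∣ TW1 ∣ ATT; rc 0, sorries = stubs); child route V-R′ `vr.route.json` + `vr.glue.lean` (native check OK, cone 5/5; tribunal --full tk=PROVISIONAL,
t1 clean ×5, XIR residual) = g32's queued V-R with ATR replaced — ONE filing for the writer, not two.
-/


namespace Summit.Langlands.Langlands.Theorems.AbelianTypeDissolution

/-! ## 1. Vocabulary (structured forms; the ITEMS below are inlined one-liners, tied to these by `Iff.rfl`) -/

section Vocabulary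

variable (K : Type) [Field K] [NumberField K] (ℓ : ℕ) [Fact ℓ.Prime] (n : ℕ)
  (ρ : Literature.NumberTheory.GaloisRepresentations.FramedGaloisRep K (PadicAlgCl ℓ) n)

/-- PINNED-GEOMETRIC (the host's hypothesis block VERBATIM): unramified at almost every finite place and de Rham at
every `v ∣ ℓ` for Fontaine's pinned period datum. (Fontaine–Mazur 1995 §1; a predicate, not a citable fact.) -/
def IsPinnedGeometric : Prop :=
  ((∀ᶠ v : IsDedekindDomain.HeightOneSpectrum (NumberField.RingOfIntegers K) in Filter.cofinite, ρ.IsUnramifiedAt v) ∧ ∀ (v : IsDedekindDomain.HeightOneSpectrum (NumberField.RingOfIntegers K)) (hv : ((ℓ : ℕ) : NumberField.RingOfIntegers K) ∈ v.asIdeal), (Literature.NumberTheory.PAdicHodge.fontainePstAdicCompletion v ℓ hv).IsDeRhamFramed (ρ.toLocal v))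

/-- **WEIGHT-ONE FACTOR**: `σ : Γ_K → GL_m(ℚ̄_ℓ)` framed with `0 < m`, irreducible, pinned-geometric and REALISABLE IN
DEGREE ONE (`AbelianTypeSplit.IsEtaleSubquotientInDegree K ℓ m σ 1`, the landed g32/host predicate: an `ε^j`-twisted
Γ_K-subquotient of some `ℚ̄_ℓ ⊗ H¹(X_{K̄}, ℚ_ℓ)`, X smooth projective /K; since `H¹(X) = H¹(Alb X)` these are the
irreducible constituents of Tate modules of abelian varieties, twisted) — i.e. EXACTLY the population of the parent's
cell AVR = `MotivicDictionarySplit.AbelianMotivicReciprocity` (stmt-Langlands-27425): the GENERATORS of the weight-one hull. -/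
def IsWeightOneFactor (m : ℕ) (σ : Literature.NumberTheory.GaloisRepresentations.FramedGaloisRep K (PadicAlgCl ℓ) m) : Prop :=
  0 < m ∧ σ.toGaloisRep.IsIrreducible ∧ IsPinnedGeometric K ℓ m σ ∧
    Summit.Langlands.Langlands.Theorems.AbelianTypeSplit.IsEtaleSubquotientInDegree K ℓ m σ 1

/-- the k-ary KRONECKER PRODUCT of square matrices `M i : Matrix (Fin (m i)) (Fin (m i)) R` on the index type
`Π i, Fin (m i)`: entry `(x, y) ↦ ∏ i, M i (x i) (y i)` — the matrix of `⨂_i M i` in the product basis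
(Mathlib's `Matrix.kroneckerMap (·*·)` is the case k = 2 up to `Matrix.reindex`). -/
def kroneckerPi {R : Type*} [CommRing R] (k : ℕ) (m : Fin k → ℕ) (M : (i : Fin k) → Matrix (Fin (m i)) (Fin (m i)) R) :
    Matrix ((i : Fin k) → Fin (m i)) ((i : Fin k) → Fin (m i)) R :=
  Matrix.of fun x y => ∏ i : Fin k, M i (x i) (y i)

/-- **TWISTED TENSOR CONSTITUENT** (Galois side, charpoly form): `ρ` is an `ε_ℓ^j`-twisted JORDAN–HÖLDER CONSTITUENT of
`ρs 0 ⊗ ⋯ ⊗ ρs (k-1)`: there are a twist `j : ℤ` and a framed COMPLEMENT `ρ' : Γ_K → GL_{n'}(ℚ̄_ℓ)` with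
`charpoly ρ(g) · charpoly ρ'(g) = charpoly(ε(g)^j • ⨂_i ρs_i(g))` for every `g ∈ Γ_K` — by Brauer–Nesbitt (char 0)
exactly «ρ ⊕ ρ' and (⨂_i ρs_i)(ε^j) have isomorphic semisimplifications», i.e. the irreducible ρ OCCURS in the twisted
tensor product.  Typing style of the tree's Kronecker dial (`KroneckerPrimitivitySplit`: `charpoly ρ g =
(Matrix.kroneckerMap (·*·) (ρ₁ g) (ρ₂ g)).charpoly`), generalised from «EQUAL to a 2-fold product» to «CONSTITUENT of a
k-fold product, up to Tate twist» (Curtis–Reiner (30.16); folklore). -/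
def IsTwistedTensorConstituentOf (k : ℕ) (m : Fin k → ℕ)
    (ρs : (i : Fin k) → Literature.NumberTheory.GaloisRepresentations.FramedGaloisRep K (PadicAlgCl ℓ) (m i)) : Prop :=
  ∃ (j : ℤ) (n' : ℕ) (ρ' : Literature.NumberTheory.GaloisRepresentations.FramedGaloisRep K (PadicAlgCl ℓ) n'),
    ∀ g : Field.absoluteGaloisGroup K,
      Literature.NumberTheory.GaloisRepresentations.FramedRep.charpoly ρ g *
          Literature.NumberTheory.GaloisRepresentations.FramedRep.charpoly ρ' g =
        ((algebraMap ℚ_[ℓ] (PadicAlgCl ℓ) ((Literature.AlgebraicGeometry.Motives.padicCyclotomicCharacter K ℓ g : ℚ_[ℓ]ˣ) : ℚ_[ℓ])) ^ j •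
          kroneckerPi k m (fun i => (((ρs i) g : GL (Fin (m i)) (PadicAlgCl ℓ)) : Matrix (Fin (m i)) (Fin (m i)) (PadicAlgCl ℓ)))).charpoly

/-- **WEIGHT-ONE TENSOR TYPE** (the Galois-side reading of «abelian type»): `ρ` is an `ε^j`-twisted Jordan–Hölder
constituent of a tensor product `ρs 0 ⊗ ⋯ ⊗ ρs (k-1)` of WEIGHT-ONE FACTORS (k ≥ 0; k = 0 ⇒ ρ = ε^j).  In nature
(H•(A) = ⋀•H¹(A) ⊂ ⊗•H¹(A), Künneth, Faltings' semisimplicity, H¹(X) = H¹(Alb X), Weil restriction) this is EQUIVALENT,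
for irreducible geometric ρ, to g32's dial `AbelianTypeSplit.IsAbelianTypeRealisable` («realisable in some Hⁱ of an
abelian variety over K»); the two implications are typed below as the dictionary doors ATT (item) and TTA (node-only).
(André 1996 §6.1; Deligne–Milne–Ogus–Shih 1982 II.6.) -/
def IsWeightOneTensorConstituent : Prop :=
  ∃ (k : ℕ) (m : Fin k → ℕ) (ρs : (i : Fin k) → Literature.NumberTheory.GaloisRepresentations.FramedGaloisRep K (PadicAlgCl ℓ) (m i)),
    (∀ i : Fin k, IsWeightOneFactor K ℓ (m i) (ρs i)) ∧ IsTwistedTensorConstituentOf K ℓ n ρ k m ρs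

/-- tie: the structured dial IS the inline text used in the items (conclusion of ATT; destructured by the seam). -/
theorem isWeightOneTensorConstituent_iff :
    IsWeightOneTensorConstituent K ℓ n ρ ↔ (∃ (k : ℕ) (m : Fin k → ℕ) (ρs : (i : Fin k) → Literature.NumberTheory.GaloisRepresentations.FramedGaloisRep K (PadicAlgCl ℓ) (m i)), (∀ i : Fin k, (0 < m i ∧ (ρs i).toGaloisRep.IsIrreducible ∧ ((∀ᶠ v : IsDedekindDomain.HeightOneSpectrum (NumberField.RingOfIntegers K) in Filter.cofinite, (ρs i).IsUnramifiedAt v) ∧ ∀ (v : IsDedekindDomain.HeightOneSpectrum (NumberField.RingOfIntegers K)) (hv : ((ℓ : ℕ) : NumberField.RingOfIntegers K) ∈ v.asIdeal), (Literature.NumberTheory.PAdicHodge.fontainePstAdicCompletion v ℓ hv).IsDeRhamFramed ((ρs i).toLocal v)) ∧ (∃ (d : ℕ) (X : Literature.AlgebraicGeometry.Motives.SchemeOver K), Literature.AlgebraicGeometry.Motives.IsSmoothProjective d X ∧ ∃ (j : ℤ) (W : Submodule (PadicAlgCl ℓ) (TensorProduct ℚ_[ℓ] (PadicAlgCl ℓ)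 (Literature.AlgebraicGeometry.Motives.ellAdicEtaleCohomologyRat ℓ 1 (Literature.AlgebraicGeometry.Motives.geometricFibre K X)))) (hW : ∀ (g : Field.absoluteGaloisGroup K) (w : TensorProduct ℚ_[ℓ] (PadicAlgCl ℓ) (Literature.AlgebraicGeometry.Motives.ellAdicEtaleCohomologyRat ℓ 1 (Literature.AlgebraicGeometry.Motives.geometricFibre K X))), w ∈ W → (algebraMap ℚ_[ℓ] (PadicAlgCl ℓ) ((Literature.AlgebraicGeometry.Motives.padicCyclotomicCharacter K ℓ g : ℚ_[ℓ]ˣ) : ℚ_[ℓ])) ^ j • (Literature.AlgebraicGeometry.Motives.geometricEllAdicEtaleCohomologyRepRat ℓ X 1 g).baseChange (PadicAlgCl ℓ) w ∈ W) (f : W →ₗ[PadicAlgCl ℓ] (Fin (m i) → PadicAlgCl ℓ)), Function.Surjective f ∧ ∀ (g : Field.absoluteGaloisGroup K) (w : W), f ⟨(algebraMap ℚ_[ℓ] (PadicAlgCl ℓ) ((Literature.AlgebraicGeometry.Motives.padicCyclotomicCharacter K ℓ g : ℚ_[ℓ]ˣ) : ℚ_[ℓ])) ^ j • (Literature.AlgebraicGeometry.Motives.geometricEllAdicEtaleCohomologyRepRat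 ℓ X 1 g).baseChange (PadicAlgCl ℓ) (w : TensorProduct ℚ_[ℓ] (PadicAlgCl ℓ) (Literature.AlgebraicGeometry.Motives.ellAdicEtaleCohomologyRat ℓ 1 (Literature.AlgebraicGeometry.Motives.geometricFibre K X))), hW g w w.2⟩ = (((ρs i) g : GL (Fin (m i)) (PadicAlgCl ℓ)) : Matrix (Fin (m i)) (Fin (m i)) (PadicAlgCl ℓ)).mulVec (f w)))) ∧ (∃ (j : ℤ) (n' : ℕ) (ρ' : Literature.NumberTheory.GaloisRepresentations.FramedGaloisRep K (PadicAlgCl ℓ) n'), ∀ g : Field.absoluteGaloisGroup K, Literature.NumberTheory.GaloisRepresentations.FramedRep.charpoly ρ g * Literature.NumberTheory.GaloisRepresentations.FramedRep.charpoly ρ' g = ((algebraMap ℚ_[ℓ] (PadicAlgCl ℓ) ((Literature.AlgebraicGeometry.Motives.padicCyclotomicCharacter K ℓ g : ℚ_[ℓ]ˣ) : ℚ_[ℓ])) ^ j • (Matrix.of fun (x y : (i : Fin k) → Fin (m i)) => ∏ i : Fin k, (((ρs i) g : GL (Fin (m i)) (PadicAlgCl ℓ)) : Matrix (Fin (m i))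 (Fin (m i)) (PadicAlgCl ℓ)) (x i) (y i))).charpoly)) :=
  Iff.rfl

end Vocabulary

/-! ## 2. The pieces (ITEMS: one-liners, generator texts33.py; the blocks are the host's VERBATIM blocks) -/

/-- **TW1 — WEIGHT-ONE TENSOR TRANSPORT** (NEW crux r2; the FUNCTORIALITY piece): for every number field K, prime ℓ,
ι : ℚ̄_ℓ ≃ ℂ and every finite family of WEIGHT-ONE FACTORS `ρs i : Γ_K → GL_{m i}(ℚ̄_ℓ)` EACH WEAKLY AUTOMORPHIC
(an L-algebraic cuspidal π_i on GL_{m i}/K with Satake = Frobenius a.e.), every irreducible pinned-geometric ρ that is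
an ε^j-twisted Jordan–Hölder constituent of ⨂_i ρs_i is weakly automorphic (L-algebraic cuspidal π on GL_n/K).
«Weak automorphy is CLOSED under twisted tensor constituents of weakly automorphic weight-one irreducibles.»
Print rungs over EVERY number field K, in IRREGULAR weight (outside every proved case of S): shape (2,2) =
Ramakrishnan 2000 Thm M + cuspidality criterion (tree `Ramakrishnan2000_theoremM` / `WeakTensorProductFunctoriality 2 2`);
shape (2,3) = Kim–Shahidi 2002 (tree `KimShahidi2002_functorialProduct_GL2GL3` / `WeakTensorProductFunctoriality 2 3`);
Symᵐ ⊂ ⊗ᵐ of one GL₂-factor over ℚ/CM = Newton–Thorne 2021.  General shape = Langlands tensor-product functoriality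
GL_{m₁} × ⋯ × GL_{m_k} → GL_{∏ mᵢ} + isobaric-constituent bookkeeping: OPEN (IDEA-NEEDED beyond the rungs).
(Ramakrishnan 2000 Thm M; Kim–Shahidi 2002; Newton–Thorne 2021; Langlands 1970.) -/
def WeightOneTensorTransport : Prop :=
  ∀ (K : Type) [Field K] [NumberField K] (ℓ : ℕ) [Fact ℓ.Prime] (ι : PadicAlgCl ℓ ≃+* ℂ) (k : ℕ) (m : Fin k → ℕ) (hc : ∀ i : Fin k, Literature.NumberTheory.Automorphic.isCompact_glFiniteIntegralLevel (m i) K) (ρs : (i : Fin k) → Literature.NumberTheory.GaloisRepresentations.FramedGaloisRep K (PadicAlgCl ℓ) (m i)), (∀ i : Fin k, (0 < m i ∧ (ρs i).toGaloisRep.IsIrreducible ∧ ((∀ᶠ v : IsDedekindDomain.HeightOneSpectrum (NumberField.RingOfIntegers K) in Filter.cofinite, (ρs i).IsUnramifiedAt v) ∧ ∀ (v : IsDedekindDomain.HeightOneSpectrum (NumberField.RingOfIntegers K)) (hv : ((ℓ : ℕ) : NumberField.RingOfIntegers K) ∈ v.asIdeal), (Literature.NumberTheory.PAdicHodge.fontainePstAdicCompletion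 v ℓ hv).IsDeRhamFramed ((ρs i).toLocal v)) ∧ (∃ (d : ℕ) (X : Literature.AlgebraicGeometry.Motives.SchemeOver K), Literature.AlgebraicGeometry.Motives.IsSmoothProjective d X ∧ ∃ (j : ℤ) (W : Submodule (PadicAlgCl ℓ) (TensorProduct ℚ_[ℓ] (PadicAlgCl ℓ) (Literature.AlgebraicGeometry.Motives.ellAdicEtaleCohomologyRat ℓ 1 (Literature.AlgebraicGeometry.Motives.geometricFibre K X)))) (hW : ∀ (g : Field.absoluteGaloisGroup K) (w : TensorProduct ℚ_[ℓ] (PadicAlgCl ℓ) (Literature.AlgebraicGeometry.Motives.ellAdicEtaleCohomologyRat ℓ 1 (Literature.AlgebraicGeometry.Motives.geometricFibre K X))), w ∈ W → (algebraMap ℚ_[ℓ] (PadicAlgCl ℓ) ((Literature.AlgebraicGeometry.Motives.padicCyclotomicCharacter K ℓ g : ℚ_[ℓ]ˣ) : ℚ_[ℓ])) ^ j • (Literature.AlgebraicGeometry.Motives.geometricEllAdicEtaleCohomologyRepRat ℓ X 1 g).baseChange (PadicAlgCl ℓ) w ∈ W) (f : W →ₗ[PadicAlgCl ℓ] (Fin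 (m i) → PadicAlgCl ℓ)), Function.Surjective f ∧ ∀ (g : Field.absoluteGaloisGroup K) (w : W), f ⟨(algebraMap ℚ_[ℓ] (PadicAlgCl ℓ) ((Literature.AlgebraicGeometry.Motives.padicCyclotomicCharacter K ℓ g : ℚ_[ℓ]ˣ) : ℚ_[ℓ])) ^ j • (Literature.AlgebraicGeometry.Motives.geometricEllAdicEtaleCohomologyRepRat ℓ X 1 g).baseChange (PadicAlgCl ℓ) (w : TensorProduct ℚ_[ℓ] (PadicAlgCl ℓ) (Literature.AlgebraicGeometry.Motives.ellAdicEtaleCohomologyRat ℓ 1 (Literature.AlgebraicGeometry.Motives.geometricFibre K X))), hW g w w.2⟩ = (((ρs i) g : GL (Fin (m i)) (PadicAlgCl ℓ)) : Matrix (Fin (m i)) (Fin (m i)) (PadicAlgCl ℓ)).mulVec (f w))) ∧ ∃ π : Literature.NumberTheory.Automorphic.CuspidalAutomorphicRepData (m i) K (hc i), π.1.IsLAlgebraic ∧ ∀ᶠ v : IsDedekindDomain.HeightOneSpectrum (NumberField.RingOfIntegers K) in Filter.cofinite, Summit.Langlands.SatakeFrobCompatibleAt ι π.1 (ρs i) v)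 → ∀ (n : ℕ) (hcpt : Literature.NumberTheory.Automorphic.isCompact_glFiniteIntegralLevel n K), 0 < n → ∀ (ρ : Literature.NumberTheory.GaloisRepresentations.FramedGaloisRep K (PadicAlgCl ℓ) n), ρ.toGaloisRep.IsIrreducible → ((∀ᶠ v : IsDedekindDomain.HeightOneSpectrum (NumberField.RingOfIntegers K) in Filter.cofinite, ρ.IsUnramifiedAt v) ∧ ∀ (v : IsDedekindDomain.HeightOneSpectrum (NumberField.RingOfIntegers K)) (hv : ((ℓ : ℕ) : NumberField.RingOfIntegers K) ∈ v.asIdeal), (Literature.NumberTheory.PAdicHodge.fontainePstAdicCompletion v ℓ hv).IsDeRhamFramed (ρ.toLocal v)) → (∃ (j : ℤ) (n' : ℕ) (ρ' : Literature.NumberTheory.GaloisRepresentations.FramedGaloisRep K (PadicAlgCl ℓ) n'), ∀ g : Field.absoluteGaloisGroup K, Literature.NumberTheory.GaloisRepresentations.FramedRep.charpoly ρ g * Literature.NumberTheory.GaloisRepresentations.FramedRep.charpoly ρ' g = ((algebraMap ℚ_[ℓ] (PadicAlgCl ℓ) ((Literature.AlgebraicGeometry.Motives.padicCyclotomicCharacter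 K ℓ g : ℚ_[ℓ]ˣ) : ℚ_[ℓ])) ^ j • (Matrix.of fun (x y : (i : Fin k) → Fin (m i)) => ∏ i : Fin k, (((ρs i) g : GL (Fin (m i)) (PadicAlgCl ℓ)) : Matrix (Fin (m i)) (Fin (m i)) (PadicAlgCl ℓ)) (x i) (y i))).charpoly) → ∃ π : Literature.NumberTheory.Automorphic.CuspidalAutomorphicRepData n K hcpt, π.1.IsLAlgebraic ∧ ∀ᶠ v : IsDedekindDomain.HeightOneSpectrum (NumberField.RingOfIntegers K) in Filter.cofinite, Summit.Langlands.SatakeFrobCompatibleAt ι π.1 ρ v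

/-- **ATT — ABELIAN TYPE IS TENSOR-GENERATED BY WEIGHT ONE** (NEW support/crux r5; the DICTIONARY DOOR, a theorem IN
PRINT, no automorphic content): every irreducible pinned-geometric ρ : Γ_K → GL_n(ℚ̄_ℓ) (n > 0) realisable as an
ε^j-twisted Γ_K-subquotient of some ℚ̄_ℓ ⊗ Hⁱ(A_{K̄}, ℚ_ℓ), A an abelian variety over K (g32's dial VERBATIM), is of
weight-one tensor type.  Print proof: Hⁱ(A) ≅ ⋀ⁱH¹(A) ⊂ H¹(A)^{⊗ i} Γ_K-equivariantly (cup product; Mumford AV §IV /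
Milne AV Thm 12.1(15.1)); ℚ̄_ℓ ⊗ H¹(A) is semisimple (Faltings 1983) hence so is every twisted tensor power (Chevalley),
so a subquotient is a constituent; decompose ℚ̄_ℓ ⊗ H¹(A) = ⊕ σ_t into irreducibles — each σ_t is a weight-one factor
realised on X = A itself (smooth projective: Mumford), unramified a.e. (Néron–Ogg–Shafarevich / smooth base change) and
de Rham at v ∣ ℓ (Fontaine–Messing / Faltings / Tsuji C_dR) — and ρ irreducible occurs in one σ_{t₁} ⊗ ⋯ ⊗ σ_{tᵢ}(ε^j).
Lean status: the tree's `ellAdicEtaleCohomologyRat` has no Künneth / cup-product structure yet (critic row 446 C5: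
«dial not Lean-instrumentable») — ATTACKABLE as typing work (three Literature facts), never an idea. -/
def AbelianTypeIsTensorGenerated : Prop :=
  ∀ (K : Type) [Field K] [NumberField K] (ℓ : ℕ) [Fact ℓ.Prime] (n : ℕ) (ρ : Literature.NumberTheory.GaloisRepresentations.FramedGaloisRep K (PadicAlgCl ℓ) n), 0 < n → ρ.toGaloisRep.IsIrreducible → ((∀ᶠ v : IsDedekindDomain.HeightOneSpectrum (NumberField.RingOfIntegers K) in Filter.cofinite, ρ.IsUnramifiedAt v) ∧ ∀ (v : IsDedekindDomain.HeightOneSpectrum (NumberField.RingOfIntegers K)) (hv : ((ℓ : ℕ) : NumberField.RingOfIntegers K) ∈ v.asIdeal), (Literature.NumberTheory.PAdicHodge.fontainePstAdicCompletion v ℓ hv).IsDeRhamFramed (ρ.toLocal v)) → (∃ (i : ℕ) (A : Literature.AlgebraicGeometry.Motives.AbelianVariety K), ∃ (j : ℤ) (W : Submodule (PadicAlgCl ℓ) (TensorProduct ℚ_[ℓ] (PadicAlgCl ℓ) (Literature.AlgebraicGeometry.Motives.ellAdicEtaleCohomologyRat ℓ i (Literature.AlgebraicGeometry.Motives.geometricFibre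 K A.X)))) (hW : ∀ (g : Field.absoluteGaloisGroup K) (w : TensorProduct ℚ_[ℓ] (PadicAlgCl ℓ) (Literature.AlgebraicGeometry.Motives.ellAdicEtaleCohomologyRat ℓ i (Literature.AlgebraicGeometry.Motives.geometricFibre K A.X))), w ∈ W → (algebraMap ℚ_[ℓ] (PadicAlgCl ℓ) ((Literature.AlgebraicGeometry.Motives.padicCyclotomicCharacter K ℓ g : ℚ_[ℓ]ˣ) : ℚ_[ℓ])) ^ j • (Literature.AlgebraicGeometry.Motives.geometricEllAdicEtaleCohomologyRepRat ℓ A.X i g).baseChange (PadicAlgCl ℓ) w ∈ W) (f : W →ₗ[PadicAlgCl ℓ] (Fin n → PadicAlgCl ℓ)), Function.Surjective f ∧ ∀ (g : Field.absoluteGaloisGroup K) (w : W), f ⟨(algebraMap ℚ_[ℓ] (PadicAlgCl ℓ) ((Literature.AlgebraicGeometry.Motives.padicCyclotomicCharacter K ℓ g : ℚ_[ℓ]ˣ) : ℚ_[ℓ])) ^ j • (Literature.AlgebraicGeometry.Motives.geometricEllAdicEtaleCohomologyRepRat ℓ A.X i g).baseChange (PadicAlgCl ℓ) (w : TensorProduct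 ℚ_[ℓ] (PadicAlgCl ℓ) (Literature.AlgebraicGeometry.Motives.ellAdicEtaleCohomologyRat ℓ i (Literature.AlgebraicGeometry.Motives.geometricFibre K A.X))), hW g w w.2⟩ = ((ρ g : GL (Fin n) (PadicAlgCl ℓ)) : Matrix (Fin n) (Fin n) (PadicAlgCl ℓ)).mulVec (f w)) → (∃ (k : ℕ) (m : Fin k → ℕ) (ρs : (i : Fin k) → Literature.NumberTheory.GaloisRepresentations.FramedGaloisRep K (PadicAlgCl ℓ) (m i)), (∀ i : Fin k, (0 < m i ∧ (ρs i).toGaloisRep.IsIrreducible ∧ ((∀ᶠ v : IsDedekindDomain.HeightOneSpectrum (NumberField.RingOfIntegers K) in Filter.cofinite, (ρs i).IsUnramifiedAt v) ∧ ∀ (v : IsDedekindDomain.HeightOneSpectrum (NumberField.RingOfIntegers K)) (hv : ((ℓ : ℕ) : NumberField.RingOfIntegers K) ∈ v.asIdeal), (Literature.NumberTheory.PAdicHodge.fontainePstAdicCompletion v ℓ hv).IsDeRhamFramed ((ρs i).toLocal v)) ∧ (∃ (d : ℕ) (X : Literature.AlgebraicGeometry.Motives.SchemeOver K), Literature.AlgebraicGeometry.Motives.IsSmoothProjective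 d X ∧ ∃ (j : ℤ) (W : Submodule (PadicAlgCl ℓ) (TensorProduct ℚ_[ℓ] (PadicAlgCl ℓ) (Literature.AlgebraicGeometry.Motives.ellAdicEtaleCohomologyRat ℓ 1 (Literature.AlgebraicGeometry.Motives.geometricFibre K X)))) (hW : ∀ (g : Field.absoluteGaloisGroup K) (w : TensorProduct ℚ_[ℓ] (PadicAlgCl ℓ) (Literature.AlgebraicGeometry.Motives.ellAdicEtaleCohomologyRat ℓ 1 (Literature.AlgebraicGeometry.Motives.geometricFibre K X))), w ∈ W → (algebraMap ℚ_[ℓ] (PadicAlgCl ℓ) ((Literature.AlgebraicGeometry.Motives.padicCyclotomicCharacter K ℓ g : ℚ_[ℓ]ˣ) : ℚ_[ℓ])) ^ j • (Literature.AlgebraicGeometry.Motives.geometricEllAdicEtaleCohomologyRepRat ℓ X 1 g).baseChange (PadicAlgCl ℓ) w ∈ W) (f : W →ₗ[PadicAlgCl ℓ] (Fin (m i) → PadicAlgCl ℓ)), Function.Surjective f ∧ ∀ (g : Field.absoluteGaloisGroup K) (w : W), f ⟨(algebraMap ℚ_[ℓ] (PadicAlgCl ℓ) ((Literature.AlgebraicGeometry.Motives.padicCyclotomicCharacter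 K ℓ g : ℚ_[ℓ]ˣ) : ℚ_[ℓ])) ^ j • (Literature.AlgebraicGeometry.Motives.geometricEllAdicEtaleCohomologyRepRat ℓ X 1 g).baseChange (PadicAlgCl ℓ) (w : TensorProduct ℚ_[ℓ] (PadicAlgCl ℓ) (Literature.AlgebraicGeometry.Motives.ellAdicEtaleCohomologyRat ℓ 1 (Literature.AlgebraicGeometry.Motives.geometricFibre K X))), hW g w w.2⟩ = (((ρs i) g : GL (Fin (m i)) (PadicAlgCl ℓ)) : Matrix (Fin (m i)) (Fin (m i)) (PadicAlgCl ℓ)).mulVec (f w)))) ∧ (∃ (j : ℤ) (n' : ℕ) (ρ' : Literature.NumberTheory.GaloisRepresentations.FramedGaloisRep K (PadicAlgCl ℓ) n'), ∀ g : Field.absoluteGaloisGroup K, Literature.NumberTheory.GaloisRepresentations.FramedRep.charpoly ρ g * Literature.NumberTheory.GaloisRepresentations.FramedRep.charpoly ρ' g = ((algebraMap ℚ_[ℓ] (PadicAlgCl ℓ) ((Literature.AlgebraicGeometry.Motives.padicCyclotomicCharacter K ℓ g : ℚ_[ℓ]ˣ) : ℚ_[ℓ])) ^ j • (Matrix.of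 fun (x y : (i : Fin k) → Fin (m i)) => ∏ i : Fin k, (((ρs i) g : GL (Fin (m i)) (PadicAlgCl ℓ)) : Matrix (Fin (m i)) (Fin (m i)) (PadicAlgCl ℓ)) (x i) (y i))).charpoly))

/-! ### node-only statements (never items) -/

/-- TCT — TENSOR CONSTITUENT TRANSPORT (node-only; the GENERAL closure statement with arbitrary irreducible pinned-geometric
weakly automorphic factors).  B_w ⟹ TCT ⟹ TW1: TW1 is the weight-one SHADOW of plain tensor-product functoriality on
the Galois-attached spectrum. -/
def TensorConstituentTransport : Prop :=
  ∀ (K : Type) [Field K] [NumberField K] (ℓ : ℕ) [Fact ℓ.Prime] (ι : PadicAlgCl ℓ ≃+* ℂ) (k : ℕ) (m : Fin k → ℕ) (hc : ∀ i : Fin k, Literature.NumberTheory.Automorphic.isCompact_glFiniteIntegralLevel (m i) K) (ρs : (i : Fin k) → Literature.NumberTheory.GaloisRepresentations.FramedGaloisRep K (PadicAlgCl ℓ) (m i)), (∀ i : Fin k, (0 < m i ∧ (ρs i).toGaloisRep.IsIrreducible ∧ ((∀ᶠ v : IsDedekindDomain.HeightOneSpectrum (NumberField.RingOfIntegers K)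 in Filter.cofinite, (ρs i).IsUnramifiedAt v) ∧ ∀ (v : IsDedekindDomain.HeightOneSpectrum (NumberField.RingOfIntegers K)) (hv : ((ℓ : ℕ) : NumberField.RingOfIntegers K) ∈ v.asIdeal), (Literature.NumberTheory.PAdicHodge.fontainePstAdicCompletion v ℓ hv).IsDeRhamFramed ((ρs i).toLocal v))) ∧ ∃ π : Literature.NumberTheory.Automorphic.CuspidalAutomorphicRepData (m i) K (hc i), π.1.IsLAlgebraic ∧ ∀ᶠ v : IsDedekindDomain.HeightOneSpectrum (NumberField.RingOfIntegers K) in Filter.cofinite, Summit.Langlands.SatakeFrobCompatibleAt ι π.1 (ρs i) v) → ∀ (n : ℕ) (hcpt : Literature.NumberTheory.Automorphic.isCompact_glFiniteIntegralLevel n K), 0 < n → ∀ (ρ : Literature.NumberTheory.GaloisRepresentations.FramedGaloisRep K (PadicAlgCl ℓ) n), ρ.toGaloisRep.IsIrreducible → ((∀ᶠ v : IsDedekindDomain.HeightOneSpectrum (NumberField.RingOfIntegers K) in Filter.cofinite, ρ.IsUnramifiedAt v) ∧ ∀ (v : IsDedekindDomain.HeightOneSpectrum (NumberField.RingOfIntegers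 K)) (hv : ((ℓ : ℕ) : NumberField.RingOfIntegers K) ∈ v.asIdeal), (Literature.NumberTheory.PAdicHodge.fontainePstAdicCompletion v ℓ hv).IsDeRhamFramed (ρ.toLocal v)) → (∃ (j : ℤ) (n' : ℕ) (ρ' : Literature.NumberTheory.GaloisRepresentations.FramedGaloisRep K (PadicAlgCl ℓ) n'), ∀ g : Field.absoluteGaloisGroup K, Literature.NumberTheory.GaloisRepresentations.FramedRep.charpoly ρ g * Literature.NumberTheory.GaloisRepresentations.FramedRep.charpoly ρ' g = ((algebraMap ℚ_[ℓ] (PadicAlgCl ℓ) ((Literature.AlgebraicGeometry.Motives.padicCyclotomicCharacter K ℓ g : ℚ_[ℓ]ˣ) : ℚ_[ℓ])) ^ j • (Matrix.of fun (x y : (i : Fin k) → Fin (m i)) => ∏ i : Fin k, (((ρs i) g : GL (Fin (m i)) (PadicAlgCl ℓ)) : Matrix (Fin (m i)) (Fin (m i)) (PadicAlgCl ℓ)) (x i) (y i))).charpoly) → ∃ π : Literature.NumberTheory.Automorphic.CuspidalAutomorphicRepData n K hcpt, π.1.IsLAlgebraic ∧ ∀ᶠ v : IsDedekindDomain.HeightOneSpectrum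 (NumberField.RingOfIntegers K) in Filter.cofinite, Summit.Langlands.SatakeFrobCompatibleAt ι π.1 ρ v

/-- TTR — TENSOR-TYPE RECIPROCITY (node-only CELL): HMR for the ρ of weight-one tensor type.  TTR ⟸ AVR ∧ TW1 (seam 1,
no dictionary); HMR ⟹ TTR; ATR ⟺ TTR modulo the dictionary doors. -/
def TensorTypeReciprocity : Prop :=
  ∀ (K : Type) [Field K] [NumberField K] (n : ℕ) (hcpt : Literature.NumberTheory.Automorphic.isCompact_glFiniteIntegralLevel n K), 0 < n →
    ∀ (ℓ : ℕ) [Fact ℓ.Prime] (ι : PadicAlgCl ℓ ≃+* ℂ) (ρ : Literature.NumberTheory.GaloisRepresentations.FramedGaloisRep K (PadicAlgCl ℓ) n),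
      ρ.toGaloisRep.IsIrreducible → IsPinnedGeometric K ℓ n ρ →
      (¬ Summit.Langlands.Langlands.Theorems.AbelianTypeSplit.IsEtaleSubquotientInDegree K ℓ n ρ 1 ∧
          ∃ i : ℕ, Summit.Langlands.Langlands.Theorems.AbelianTypeSplit.IsEtaleSubquotientInDegree K ℓ n ρ i) →
      IsWeightOneTensorConstituent K ℓ n ρ →
        ∃ π : Literature.NumberTheory.Automorphic.CuspidalAutomorphicRepData n K hcpt,
          π.1.IsLAlgebraic ∧ ∀ᶠ v : IsDedekindDomain.HeightOneSpectrum (NumberField.RingOfIntegers K) in Filter.cofinite,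
            Summit.Langlands.SatakeFrobCompatibleAt ι π.1 ρ v

/-- TTA — TENSOR TYPE IS ABELIAN TYPE (node-only; the CONVERSE dictionary door, print: Künneth for smooth projective
X_t, H¹(X) = H¹(Alb X), products of abelian varieties): on HMR's population, weight-one tensor type ⟹ abelian-type
realisable.  Used only for the exactness certificate `abelianTypeReciprocity_iff_tensorTypeReciprocity`. -/
def TensorTypeIsAbelianType : Prop :=
  ∀ (K : Type) [Field K] [NumberField K] (ℓ : ℕ) [Fact ℓ.Prime] (n : ℕ)
    (ρ : Literature.NumberTheory.GaloisRepresentations.FramedGaloisRep K (PadicAlgCl ℓ) n), 0 < n →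
      ρ.toGaloisRep.IsIrreducible → IsPinnedGeometric K ℓ n ρ →
      (¬ Summit.Langlands.Langlands.Theorems.AbelianTypeSplit.IsEtaleSubquotientInDegree K ℓ n ρ 1 ∧
          ∃ i : ℕ, Summit.Langlands.Langlands.Theorems.AbelianTypeSplit.IsEtaleSubquotientInDegree K ℓ n ρ i) →
      IsWeightOneTensorConstituent K ℓ n ρ →
        Summit.Langlands.Langlands.Theorems.AbelianTypeSplit.IsAbelianTypeRealisable K ℓ n ρ

/-! ## 3. Kernel -/

/-- **SEAM 1 (generators + closure): AVR ∧ TW1 ⟹ TTR.**  Given ρ of weight-one tensor type, each factor `ρs i` is a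
weight-one factor, hence weakly automorphic by the parent's cell AVR (27425, BY NAME) at the compact level supplied by
the tree theorem `isCompact_glFiniteIntegralLevel_holds (m i) K`; TW1 transports.  Pure logic. -/
theorem tensorTypeReciprocity_of_pieces
    (hA : Summit.Langlands.Langlands.Theses.MotivicDictionarySplit.AbelianMotivicReciprocity)
    (hT : WeightOneTensorTransport) : TensorTypeReciprocity := by
  intro K _ _ n hcpt hn ℓ _ ι ρ hirr hgeom _ hTT
  obtain ⟨k, m, ρs, hfac, hid⟩ := hTT
  exact hT K ℓ ι k m (fun i => Literature.NumberTheory.Automorphic.isCompact_glFiniteIntegralLevel_holds (m i) K) ρs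
    (fun i => ⟨hfac i, hA K (m i) _ (hfac i).1 ℓ ι (ρs i) (hfac i).2.1 (hfac i).2.2.1 (hfac i).2.2.2⟩)
    n hcpt hn ρ hirr hgeom hid

/-- **SEAM 2 — THE DISSOLUTION OF THE SPECIAL CELL: AVR ∧ TW1 ∧ ATT ⟹ ATR** (g32's landed cell
`AbelianTypeSplit.AbelianTypeReciprocity`, BY NAME).  Reciprocity on the abelian-type cell = reciprocity for the
GENERATORS (AVR) + tensor-CLOSURE of automorphy (TW1) + the DICTIONARY door (ATT).  Every binder used. -/
theorem abelianTypeReciprocity_of_pieces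
    (hA : Summit.Langlands.Langlands.Theses.MotivicDictionarySplit.AbelianMotivicReciprocity)
    (hT : WeightOneTensorTransport) (hD : AbelianTypeIsTensorGenerated) :
    Summit.Langlands.Langlands.Theorems.AbelianTypeSplit.AbelianTypeReciprocity := by
  intro K _ _ n hcpt hn ℓ _ ι ρ hirr hgeom hmot hab
  exact tensorTypeReciprocity_of_pieces hA hT K n hcpt hn ℓ ι ρ hirr hgeom hmot (hD K ℓ n ρ hn hirr hgeom hab)

/-- THROUGH g32's LANDED ASSEMBLY: AVR ∧ TW1 ∧ ATT ∧ XRR ∧ XIR ⟹ HMR (`MotivicDictionarySplit.HigherMotivicReciprocity`,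
stmt-Langlands-27426, BY NAME) — `AbelianTypeSplit.closes_target` fed with the dissolved special cell.  This is the
deciding theorem of the would-be child route (vehicle V-R′: g32's V-R with ATR REPLACED by AVR + TW1 + ATT). -/
theorem closes_hmr
    (hA : Summit.Langlands.Langlands.Theses.MotivicDictionarySplit.AbelianMotivicReciprocity)
    (hT : WeightOneTensorTransport) (hD : AbelianTypeIsTensorGenerated)
    (hR : Summit.Langlands.Langlands.Theorems.AbelianTypeSplit.ExoticRegularReciprocity)
    (hI : Summit.Langlands.Langlands.Theorems.AbelianTypeSplit.ExoticIrregularReciprocity) :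
    Summit.Langlands.Langlands.Theses.MotivicDictionarySplit.HigherMotivicReciprocity :=
  Summit.Langlands.Langlands.Theorems.AbelianTypeSplit.closes_target (abelianTypeReciprocity_of_pieces hA hT hD) hR hI

/-- THROUGH THE PARENT: + NMR (27427, residual) ⟹ B_w = `PrimeSwitchSplit.WeakGeometricAutomorphy` (17414), by the
landed `MotivicDictionarySplit.closes`. -/
theorem closes_parent
    (hA : Summit.Langlands.Langlands.Theses.MotivicDictionarySplit.AbelianMotivicReciprocity)
    (hT : WeightOneTensorTransport) (hD : AbelianTypeIsTensorGenerated)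
    (hR : Summit.Langlands.Langlands.Theorems.AbelianTypeSplit.ExoticRegularReciprocity)
    (hI : Summit.Langlands.Langlands.Theorems.AbelianTypeSplit.ExoticIrregularReciprocity)
    (hN : Summit.Langlands.Langlands.Theses.MotivicDictionarySplit.NonMotivicReciprocity) :
    Summit.Langlands.Langlands.Theses.PrimeSwitchSplit.WeakGeometricAutomorphy :=
  Summit.Langlands.Langlands.Theses.MotivicDictionarySplit.closes hA (closes_hmr hA hT hD hR hI) hN

/-- ROOT: … and with N0's other five items (`PrimeSwitchSplit.closes`) the pieces decide `Langlands`. -/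
theorem closes_root
    (hA : Summit.Langlands.Langlands.Theses.MotivicDictionarySplit.AbelianMotivicReciprocity)
    (hT : WeightOneTensorTransport) (hD : AbelianTypeIsTensorGenerated)
    (hR : Summit.Langlands.Langlands.Theorems.AbelianTypeSplit.ExoticRegularReciprocity)
    (hI : Summit.Langlands.Langlands.Theorems.AbelianTypeSplit.ExoticIrregularReciprocity)
    (hN : Summit.Langlands.Langlands.Theses.MotivicDictionarySplit.NonMotivicReciprocity)
    (hW : Summit.Langlands.Langlands.Theses.PrimeSwitchSplit.SatakeAvatarExistence)
    (hP : Summit.Langlands.Langlands.Theses.PrimeSwitchSplit.PadicMemberCompatibility)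
    (hAw : Summit.Langlands.Langlands.Theses.PrimeSwitchSplit.CompatibilityAwayFromLR)
    (hRd : Summit.Langlands.Langlands.Theses.PrimeSwitchSplit.CanonicalReciprocityData)
    (hU : Summit.Langlands.Langlands.Theses.PrimeSwitchSplit.AvatarConjugacy) : _root_.Langlands :=
  Summit.Langlands.Langlands.Theses.PrimeSwitchSplit.closes (closes_parent hA hT hD hR hI hN) hW hP hAw hRd hU

/-! ### S-implied certificates (every non-dictionary piece is a consequence of B_w, hence never false short of ¬Langlands) -/

/-- B_w ⟹ TCT (drop the factor data). -/
theorem tensorConstituentTransport_of_weakGeometricAutomorphy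
    (h : Summit.Langlands.Langlands.Theses.PrimeSwitchSplit.WeakGeometricAutomorphy) : TensorConstituentTransport :=
  fun K _ _ ℓ _ ι _ _ _ _ _ n hcpt hn ρ hirr hgeom _ => h K n hcpt hn ℓ ι ρ hirr hgeom

/-- TCT ⟹ TW1 (weight-one factors are factors). -/
theorem weightOneTensorTransport_of_tensorConstituentTransport (h : TensorConstituentTransport) :
    WeightOneTensorTransport :=
  fun K _ _ ℓ _ ι k m hc ρs hfac =>
    h K ℓ ι k m hc ρs (fun i => ⟨⟨(hfac i).1.1, (hfac i).1.2.1, (hfac i).1.2.2.1⟩, (hfac i).2⟩)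

/-- B_w ⟹ TW1. -/
theorem weightOneTensorTransport_of_weakGeometricAutomorphy
    (h : Summit.Langlands.Langlands.Theses.PrimeSwitchSplit.WeakGeometricAutomorphy) : WeightOneTensorTransport :=
  weightOneTensorTransport_of_tensorConstituentTransport (tensorConstituentTransport_of_weakGeometricAutomorphy h)

/-- B_w ⟹ AVR (the parent's degree-1 cell is a restriction of B_w). -/
private theorem abelianMotivicReciprocity_of_weakGeometricAutomorphy
    (h : Summit.Langlands.Langlands.Theses.PrimeSwitchSplit.WeakGeometricAutomorphy) :
    Summit.Langlands.Langlands.Theses.MotivicDictionarySplit.AbelianMotivicReciprocity :=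
  fun K _ _ n hcpt hn ℓ _ ι ρ hirr hgeom _ => h K n hcpt hn ℓ ι ρ hirr hgeom

/-- B_w ⟹ HMR. -/
private theorem higherMotivicReciprocity_of_weakGeometricAutomorphy
    (h : Summit.Langlands.Langlands.Theses.PrimeSwitchSplit.WeakGeometricAutomorphy) :
    Summit.Langlands.Langlands.Theses.MotivicDictionarySplit.HigherMotivicReciprocity :=
  fun K _ _ n hcpt hn ℓ _ ι ρ hirr hgeom _ => h K n hcpt hn ℓ ι ρ hirr hgeom

/-- B_w ⟹ NMR. -/
private theorem nonMotivicReciprocity_of_weakGeometricAutomorphy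
    (h : Summit.Langlands.Langlands.Theses.PrimeSwitchSplit.WeakGeometricAutomorphy) :
    Summit.Langlands.Langlands.Theses.MotivicDictionarySplit.NonMotivicReciprocity :=
  fun K _ _ n hcpt hn ℓ _ ι ρ hirr hgeom _ => h K n hcpt hn ℓ ι ρ hirr hgeom

/-- HMR ⟹ TTR (restriction to the tensor-type cell). -/
theorem tensorTypeReciprocity_of_target
    (h : Summit.Langlands.Langlands.Theses.MotivicDictionarySplit.HigherMotivicReciprocity) : TensorTypeReciprocity :=
  fun K _ _ n hcpt hn ℓ _ ι ρ hirr hgeom hmot _ => h K n hcpt hn ℓ ι ρ hirr hgeom hmot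

/-! ### Exactness modulo the dictionary: ATR ⟺ TTR (the special cell IS generators + closure) -/

/-- TTR ∧ ATT ⟹ ATR. -/
theorem abelianTypeReciprocity_of_tensorTypeReciprocity (hT : TensorTypeReciprocity) (hD : AbelianTypeIsTensorGenerated) :
    Summit.Langlands.Langlands.Theorems.AbelianTypeSplit.AbelianTypeReciprocity :=
  fun K _ _ n hcpt hn ℓ _ ι ρ hirr hgeom hmot hab => hT K n hcpt hn ℓ ι ρ hirr hgeom hmot (hD K ℓ n ρ hn hirr hgeom hab)

/-- ATR ∧ TTA ⟹ TTR. -/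
theorem tensorTypeReciprocity_of_abelianTypeReciprocity
    (hA : Summit.Langlands.Langlands.Theorems.AbelianTypeSplit.AbelianTypeReciprocity) (hC : TensorTypeIsAbelianType) :
    TensorTypeReciprocity :=
  fun K _ _ n hcpt hn ℓ _ ι ρ hirr hgeom hmot htt => hA K n hcpt hn ℓ ι ρ hirr hgeom hmot (hC K ℓ n ρ hn hirr hgeom hmot htt)

/-- **EXACTNESS (mod the two PRINT dictionary doors): ATR ⟺ TTR.**  So the special cell of g32's partition carries
NO content beyond «generators + closure»: ATR ⟺ TTR ⟸ AVR ∧ TW1, with AVR, TW1 both B_w-implied. -/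
theorem abelianTypeReciprocity_iff_tensorTypeReciprocity (hD : AbelianTypeIsTensorGenerated) (hC : TensorTypeIsAbelianType) :
    Summit.Langlands.Langlands.Theorems.AbelianTypeSplit.AbelianTypeReciprocity ↔ TensorTypeReciprocity :=
  ⟨fun h => tensorTypeReciprocity_of_abelianTypeReciprocity h hC, fun h => abelianTypeReciprocity_of_tensorTypeReciprocity h hD⟩

/-- **FRAME EXACTNESS (mod ATT only): B_w ⟺ AVR ∧ TW1 ∧ XRR ∧ XIR ∧ NMR.**  Given the dictionary door, the grandparent
B_w is EXACTLY the conjunction of the four reciprocity pieces of V-R′ and the parent's residual: no piece carries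
content outside B_w (⟹: restrictions / certs) and jointly they lose nothing (⟸: `closes_parent`). -/
theorem weakGeometricAutomorphy_iff_pieces (hD : AbelianTypeIsTensorGenerated) :
    Summit.Langlands.Langlands.Theses.PrimeSwitchSplit.WeakGeometricAutomorphy ↔
      Summit.Langlands.Langlands.Theses.MotivicDictionarySplit.AbelianMotivicReciprocity ∧ WeightOneTensorTransport ∧
        Summit.Langlands.Langlands.Theorems.AbelianTypeSplit.ExoticRegularReciprocity ∧
          Summit.Langlands.Langlands.Theorems.AbelianTypeSplit.ExoticIrregularReciprocity ∧
            Summit.Langlands.Langlands.Theses.MotivicDictionarySplit.NonMotivicReciprocity :=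
  ⟨fun h => ⟨abelianMotivicReciprocity_of_weakGeometricAutomorphy h, weightOneTensorTransport_of_weakGeometricAutomorphy h,
      Summit.Langlands.Langlands.Theorems.AbelianTypeSplit.exoticRegularReciprocity_of_target
        (higherMotivicReciprocity_of_weakGeometricAutomorphy h),
      Summit.Langlands.Langlands.Theorems.AbelianTypeSplit.exoticIrregularReciprocity_of_target
        (higherMotivicReciprocity_of_weakGeometricAutomorphy h),
      nonMotivicReciprocity_of_weakGeometricAutomorphy h⟩,
    fun h => closes_parent h.1 h.2.1 hD h.2.2.1 h.2.2.2.1 h.2.2.2.2⟩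

/-- the generic side untouched: HMR ⟸ (AVR ∧ TW1 ∧ ATT) ∧ XMR, with g32's node-only `ExoticMotivicReciprocity`. -/
theorem higherMotivicReciprocity_of_generators_closure_exotic
    (hA : Summit.Langlands.Langlands.Theses.MotivicDictionarySplit.AbelianMotivicReciprocity)
    (hT : WeightOneTensorTransport) (hD : AbelianTypeIsTensorGenerated)
    (hX : Summit.Langlands.Langlands.Theorems.AbelianTypeSplit.ExoticMotivicReciprocity) :
    Summit.Langlands.Langlands.Theses.MotivicDictionarySplit.HigherMotivicReciprocity :=
  Summit.Langlands.Langlands.Theorems.AbelianTypeSplit.higherMotivicReciprocity_iff_dichotomy.2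
    ⟨abelianTypeReciprocity_of_pieces hA hT hD, hX⟩


end Summit.Langlands.Langlands.Theorems.AbelianTypeDissolution
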